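import Mathlib
import Summits.NavierStokesRegularity.NavierStokesRegularity.Theorems.TaoLadderRungTwoBreakOneShiftWindowTermFieldHom
import HarnessLib

/-!
# The one-shift window system, XXX: THE TERM-DATA LAYER — dyadic data for a term-list field with tube-valued
# tails (coefficient box; factors = physical coordinate | external value with centre box and tube radius), the
# derived sparse quadratic presentations of the CENTRE and of every ROUGH field, the field-deviation rows `cb` and
# the centre Jacobian rows, with their soundness from a single real-side relation (cell harvest/h2-tao-ladder,
# seat p2; rung1/KERNEL-CHEAP-REPLAY-SPEC.md §1 (term list), §2 (d), §6 (iv), §7 «CHECKER» (d); support for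
# K1(1) = `NoSurvivingDSSOne`, stmt-NavierStokesRegularity-20205)

MODEL lattice ODEs only (Tao 2016 §4 normal form on Tao's shift set `S`); nothing here is a statement about
the Navier–Stokes equations; no item is closed; nothing numerical is certified. Generic in `ι` (numbered by
`e : ι ≃ Fin n`) and `κ`.

REAL SIDE. A centre term list `Tc : κ → BTerm ι` (tails frozen at the tube centres) and a rough term list `Tt`
(a tail realisation at some time) with the same outputs and coefficients; a ROW ENUMERATION `rows : ι → List κ`
(`RowEnum Tc rows`: every coefficient-weighted sum over `κ` restricted to output `i` is the list sum over
`rows i` — the instance proves this once, listing the nonzero terms per site); and per row the dyadic data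
`RRows = Array (List RTermD)`, `RTermD = coef box × RFac × RFac`, `RFac = coord c | ext cen rad`, matched termwise
(`TermOK`: `coef ∈ box`, coordinate factors agree through `e`, external factors `rc ∈ cen`, `|rt − rc| ≤ rad`).
All of it: `IsRTEncl e Tc Tt rows RD`.

DERIVED DATA AND SOUNDNESS.
* `sqC n prec RD` / `sqR n prec RD` — the homogenised sparse quadratic rows (part XXVI `SQRows`) of the centre /
  rough field (external factor ↦ slot `n`, its centre box resp. tube folded into the coefficient);
  `isSQEnclosure_sqC` : `IsSQEnclosure (homQ Tc e) (sqC …)`, `isSQEnclosure_sqR` : `IsSQEnclosure (homQ Tt e) (sqR …)`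
  — so parts XXVII/XXVIII apply to the centre field, and the rough jets are enclosed for EVERY realisation;
* `cbRow prec X row` — interval of `Σ q (δa · fb_t + fa_c · δb)` over the box `X`; `abs_termField_sub_le_cbRow`:
  `|termField Tt x i − termField Tc x i| ≤ mag (cbRow …)` for `x` in the box (the `cb` of parts XVII/XXIX);
* `jacRow prec X j row` — interval of the centre Jacobian entry `∂_j (termField Tc)_i` over the box;
  `mem_jacEntry_jacRow` (the `dg`, `R` of parts XVI/XVII/XXIX).
-/

-- the sub-problem namespace repeats the summit name by design (D-0017)
set_option linter.dupNamespace false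

namespace Summit.NavierStokesRegularity.NavierStokesRegularity.Theorems

namespace DSSOneShift

open Set Finset
open Summit.NavierStokesRegularity.NavierStokesRegularity.Theorems.TaylorModelCert
open Summit.NavierStokesRegularity.NavierStokesRegularity.Theorems.TaylorModelReadout
open Summit.NavierStokesRegularity.NavierStokesRegularity.Theorems.CertificateGlueOn

/-! ### The data format -/

/-- A factor in the checker's data: a physical coordinate (flat index) or an external value given by a box of its
centre value and a tube radius. [cite: Tao2016AveragedNS, §4 (4.8); cell vocabulary, harvest/h2-tao-ladder rung1/KERNEL-CHEAP-REPLAY-SPEC.md §1 (term list, tube)] -/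
inductive RFac where
  /-- the physical coordinate with flat index `c` -/
  | coord (c : ℕ) : RFac
  /-- an external value: centre box `cen`, tube radius `rad` -/
  | ext (cen : IntervalD) (rad : Dyad) : RFac

/-- Term data: coefficient box and two factors. [folklore] -/
abbrev RTermD : Type := IntervalD × RFac × RFac

/-- Per-row term data (row `c` ↔ output with flat index `c`). [folklore] -/
abbrev RRows : Type := Array (List RTermD)

/-- Row `c` of the term data (junk `[]` beyond the size). [folklore] -/
def rrow (RD : RRows) (c : ℕ) : List RTermD := if h : c < RD.size then RD[c] else []

namespace RFac

/-- Homogenised slot: a coordinate keeps its index, an external value reads slot `n`. [folklore] -/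
def hidx (n : ℕ) : RFac → ℕ
  | coord c => c
  | ext _ _ => n

/-- The symmetric interval `[-r, r]`. [folklore] -/
def sym (r : Dyad) : IntervalD := ⟨r.neg, r⟩

/-- Centre multiplier folded into the coefficient: `[1,1]` for a coordinate, the centre box for an external value. [folklore] -/
def cmul : RFac → IntervalD
  | coord _ => IntervalD.ofInt 1
  | ext cen _ => cen

/-- Rough multiplier: `[1,1]` for a coordinate, the tube `cen + [-rad, rad]` for an external value. [folklore] -/
def rmul : RFac → IntervalD
  | coord _ => IntervalD.ofInt 1
  | ext cen rad => IntervalD.add cen (sym rad)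

/-- Value box of the CENTRE factor over a state box `X`. [folklore] -/
def cval (X : Array IntervalD) : RFac → IntervalD
  | coord c => IntervalD.aget X c
  | ext cen _ => cen

/-- Value box of a ROUGH factor over a state box `X`. [folklore] -/
def rval (X : Array IntervalD) : RFac → IntervalD
  | coord c => IntervalD.aget X c
  | ext cen rad => IntervalD.add cen (sym rad)

/-- Deviation box rough − centre: `[0,0]` for a coordinate, `[-rad, rad]` for an external value. [folklore] -/
def dev : RFac → IntervalD
  | coord _ => IntervalD.ofInt 0
  | ext _ rad => sym rad

/-- The indicator `[factor = coordinate j]` as a point interval. [folklore] -/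
def isC (j : ℕ) : RFac → IntervalD
  | coord c => if c = j then IntervalD.ofInt 1 else IntervalD.ofInt 0
  | ext _ _ => IntervalD.ofInt 0

end RFac

/-! ### Derived executable data -/

/-- The homogenised sparse row of the CENTRE field. [folklore] -/
def sqRowC (n prec : ℕ) : List RTermD → List (IntervalD × ℕ × ℕ)
  | [] => []
  | t :: l => (IntervalD.mulR prec (IntervalD.mulR prec t.1 t.2.1.cmul) t.2.2.cmul, t.2.1.hidx n, t.2.2.hidx n) ::
      sqRowC n prec l

/-- The homogenised sparse row of a ROUGH field (tubes folded into the coefficients). [folklore] -/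
def sqRowR (n prec : ℕ) : List RTermD → List (IntervalD × ℕ × ℕ)
  | [] => []
  | t :: l => (IntervalD.mulR prec (IntervalD.mulR prec t.1 t.2.1.rmul) t.2.2.rmul, t.2.1.hidx n, t.2.2.hidx n) ::
      sqRowR n prec l

/-- **The sparse quadratic presentation of the centre field** (rows `< n` from the data, row `n` empty). [folklore] -/
def sqC (n prec : ℕ) (RD : RRows) : SQRows :=
  Array.ofFn fun c : Fin (n + 1) => if (c : ℕ) < n then sqRowC n prec (rrow RD c) else []

/-- **The sparse quadratic presentation of every rough field.** [folklore] -/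
def sqR (n prec : ℕ) (RD : RRows) : SQRows :=
  Array.ofFn fun c : Fin (n + 1) => if (c : ℕ) < n then sqRowR n prec (rrow RD c) else []

/-- The field-deviation interval of one row over the state box `X`: `Σ q ⊗ (dev fa ⊗ rval fb ⊕ cval fa ⊗ dev fb)`.
[cite: Moore1979, §3.2; cell vocabulary, harvest/h2-tao-ladder rung1/KERNEL-CHEAP-REPLAY-SPEC.md §2 (d) (inclusion half-widths)] -/
def cbRow (prec : ℕ) (X : Array IntervalD) : List RTermD → IntervalD
  | [] => IntervalD.ofInt 0
  | t :: l => IntervalD.addR prec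
      (IntervalD.mulR prec t.1 (IntervalD.addR prec (IntervalD.mulR prec t.2.1.dev (t.2.2.rval X))
        (IntervalD.mulR prec (t.2.1.cval X) t.2.2.dev)))
      (cbRow prec X l)

/-- The centre Jacobian entry interval of one row and column `j` over the state box `X`:
`Σ q ⊗ ([fa = j] ⊗ cval fb ⊕ cval fa ⊗ [fb = j])`. [cite: Moore1979, §3.2; cell vocabulary, harvest/h2-tao-ladder rung1/KERNEL-CHEAP-REPLAY-SPEC.md §2 (d) (Ā from the terms)] -/
def jacRow (prec : ℕ) (X : Array IntervalD) (j : ℕ) : List RTermD → IntervalD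
  | [] => IntervalD.ofInt 0
  | t :: l => IntervalD.addR prec
      (IntervalD.mulR prec t.1 (IntervalD.addR prec (IntervalD.mulR prec (t.2.1.isC j) (t.2.2.cval X))
        (IntervalD.mulR prec (t.2.1.cval X) (t.2.2.isC j))))
      (jacRow prec X j l)

/-! ### The real-side relation -/

variable {ι : Type*} [Fintype ι] [DecidableEq ι] {κ : Type*} [Fintype κ] {n : ℕ}

/-- Data factor vs (centre factor, rough factor): a coordinate is the same physical coordinate on both sides; an
external value has its centre in the box and its rough value within the tube radius (`rad ≥ 0`). [cite: Tao2016AveragedNS, §4 (4.8); cell vocabulary, harvest/h2-tao-ladder rung1/KERNEL-CHEAP-REPLAY-SPEC.md §1 (tube)] -/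
def FacOK (e : ι ≃ Fin n) : RFac → Factor ι → Factor ι → Prop
  | RFac.coord c, φc, φt => ∃ i : ι, (e i : ℕ) = c ∧ φc = Factor.coord i ∧ φt = Factor.coord i
  | RFac.ext cen rad, φc, φt => ∃ rc rt : ℝ, φc = Factor.ext rc ∧ φt = Factor.ext rt ∧ IntervalD.mem rc cen ∧
      0 ≤ rad.toReal ∧ |rt - rc| ≤ rad.toReal

/-- Data term vs (centre term, rough term). [folklore] -/
def TermOK (e : ι ≃ Fin n) (d : RTermD) (τc τt : BTerm ι) : Prop :=
  IntervalD.mem τc.coef d.1 ∧ τt.coef = τc.coef ∧ FacOK e d.2.1 τc.fa τt.fa ∧ FacOK e d.2.2 τc.fb τt.fb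

omit [Fintype ι] in
/-- **Row enumeration**: every coefficient-weighted sum over the term index restricted to output `i` is the list
sum over `rows i` (the instance lists its nonzero terms per site; a bookkeeping predicate of the term-list data
model). [cite: Tao2016AveragedNS, §4 (4.8); cell vocabulary, harvest/h2-tao-ladder rung1/KERNEL-CHEAP-REPLAY-SPEC.md §1 (758 valid (site, term) pairs)] -/
def RowEnum (T : κ → BTerm ι) (rows : ι → List κ) : Prop :=
  ∀ (i : ι) (g : κ → ℝ), ∑ k, (T k).coefAt i * g k = ((rows i).map fun k => (T k).coef * g k).sum

/-- **The data presents the centre list `Tc` and the rough list `Tt`.** [cite: Tao2016AveragedNS, §4 (4.8); cell vocabulary, harvest/h2-tao-ladder rung1/KERNEL-CHEAP-REPLAY-SPEC.md §1] -/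
def IsRTEncl (e : ι ≃ Fin n) (Tc Tt : κ → BTerm ι) (rows : ι → List κ) (RD : RRows) : Prop :=
  RowEnum Tc rows ∧ (∀ k, (Tt k).out = (Tc k).out ∧ (Tt k).coef = (Tc k).coef) ∧
    ∀ i, List.Forall₂ (fun d k => TermOK e d (Tc k) (Tt k)) (rrow RD (e i)) (rows i)

omit [Fintype ι] [Fintype κ] in
/-- Same outputs and coefficients ⇒ same `coefAt`. [folklore] -/
theorem coefAt_eq_of_same {Tc Tt : κ → BTerm ι} (h : ∀ k, (Tt k).out = (Tc k).out ∧ (Tt k).coef = (Tc k).coef)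
    (k : κ) (i : ι) : (Tt k).coefAt i = (Tc k).coefAt i := by
  simp [BTerm.coefAt, (h k).1, (h k).2]

/-! ### Factor-level soundness -/

section FacSound

variable (e : ι ≃ Fin n)

omit [Fintype ι] [DecidableEq ι] in
/-- Symmetric interval membership. [folklore] -/
theorem mem_sym {r : Dyad} {x : ℝ} (hx : |x| ≤ r.toReal) : IntervalD.mem x (RFac.sym r) := by
  simp only [RFac.sym, IntervalD.mem, Dyad.toReal_neg]
  exact ⟨by linarith [neg_abs_le x], le_of_abs_le hx⟩

omit [Fintype ι] [DecidableEq ι] in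
/-- The real multipliers of a factor (`1` / the external values) and their homogenised reading. [folklore] -/
theorem mul_of_facOK {d : RFac} {φc φt : Factor ι} (h : FacOK e d φc φt) :
    ∃ mc mt : ℝ, IntervalD.mem mc d.cmul ∧ IntervalD.mem mt d.rmul ∧ d.hidx n < n + 1 ∧
      ∀ u : Fin (n + 1) → ℝ, φc.hval e u = mc * rdN u (d.hidx n) ∧ φt.hval e u = mt * rdN u (d.hidx n) := by
  cases d with
  | coord c =>
    obtain ⟨i, hi, rfl, rfl⟩ := h
    have h1 : IntervalD.mem (1 : ℝ) (IntervalD.ofInt 1) := by exact_mod_cast IntervalD.mem_ofInt 1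
    refine ⟨1, 1, h1, h1, by rw [RFac.hidx, ← hi]; exact Nat.lt_succ_of_lt (e i).isLt, fun u => ?_⟩
    simp only [Factor.hval, RFac.hidx, ← hi, one_mul]
    rw [rdN_of_lt _ (Nat.lt_succ_of_lt (e i).isLt)]
    exact ⟨rfl, rfl⟩
  | ext cen rad =>
    obtain ⟨rc, rt, rfl, rfl, hc, _, hdev⟩ := h
    refine ⟨rc, rt, hc, ?_, by simp [RFac.hidx], fun u => ?_⟩
    · have : rt = rc + (rt - rc) := by ring
      rw [RFac.rmul, this]; exact IntervalD.mem_add hc (mem_sym hdev)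
    · simp only [Factor.hval, RFac.hidx]
      rw [rdN_of_lt _ (Nat.lt_succ_self n)]
      exact ⟨rfl, rfl⟩

omit [Fintype ι] [DecidableEq ι] in
/-- Values over a box: centre value ∈ `cval`, rough value ∈ `rval`, their difference ∈ `dev`. [folklore] -/
theorem mem_vals {d : RFac} {φc φt : Factor ι} (h : FacOK e d φc φt) {X : Array IntervalD} {x : ι → ℝ}
    (hx : ∀ i, IntervalD.mem (x i) (IntervalD.aget X (e i))) :
    IntervalD.mem (φc.val x) (d.cval X) ∧ IntervalD.mem (φt.val x) (d.rval X) ∧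
      IntervalD.mem (φt.val x - φc.val x) d.dev := by
  cases d with
  | coord c =>
    obtain ⟨i, hi, rfl, rfl⟩ := h
    simp only [Factor.val, RFac.cval, RFac.rval, RFac.dev, ← hi, sub_self]
    exact ⟨hx i, hx i, by exact_mod_cast IntervalD.mem_ofInt 0⟩
  | ext cen rad =>
    obtain ⟨rc, rt, rfl, rfl, hc, _, hdev⟩ := h
    simp only [Factor.val, RFac.cval, RFac.rval, RFac.dev]
    refine ⟨hc, ?_, mem_sym hdev⟩
    have : rt = rc + (rt - rc) := by ring
    rw [this]; exact IntervalD.mem_add hc (mem_sym hdev)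

omit [Fintype ι] in
/-- The coordinate indicator lies in `isC`. [folklore] -/
theorem mem_isC {d : RFac} {φc φt : Factor ι} (h : FacOK e d φc φt) (j : ι) :
    IntervalD.mem (φc.isCoord j) (d.isC (e j)) := by
  cases d with
  | coord c =>
    obtain ⟨i, hi, rfl, rfl⟩ := h
    simp only [Factor.isCoord, RFac.isC, ← hi]
    by_cases hij : i = j
    · subst hij; simp only [if_true]; exact_mod_cast IntervalD.mem_ofInt 1
    · rw [if_neg hij, if_neg (fun h' => hij (e.injective (Fin.ext h')))]
      exact_mod_cast IntervalD.mem_ofInt 0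
  | ext cen rad =>
    obtain ⟨rc, rt, rfl, rfl, -, -, -⟩ := h
    simp only [Factor.isCoord, RFac.isC]
    exact_mod_cast IntervalD.mem_ofInt 0

end FacSound

end DSSOneShift

end Summit.NavierStokesRegularity.NavierStokesRegularity.Theorems
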